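/-
Copyright: lit-balaban Phase-2 proof seat p27 (gen 38).  Statement-level skeleton of a published paper; no proof claims beyond what the
kernel checks below.
-/
import Literature.MathematicalPhysics.QuantumFieldTheory.BalabanImbrieJaffe1984to88.BIJ88LocDerivHolder231RegionOfInputs
import Literature.MathematicalPhysics.QuantumFieldTheory.BalabanImbrieJaffe1984to88.BIJ88Loc231SmallPlaquetteRegion
import Literature.MathematicalPhysics.QuantumFieldTheory.BalabanImbrieJaffe1984to88.BIJ88NeumannPropagatorSmallFieldCloseHolderRegion
import Literature.MathematicalPhysics.QuantumFieldTheory.BalabanImbrieJaffe1984to88.BIJ88NeumannPropagatorSmallFieldRegionHolder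

/-!
# `BalabanImbrieJaffe1984to88.BIJ88LocDerivHolder231SmallPlaquetteRegion` — T. Bałaban, J. Imbrie, A. Jaffe, *Effective action and cluster
properties of the abelian Higgs model*, Commun. Math. Phys. **114** (1988) 257–315 [BalabanImbrieJaffe1988], Sect. 2 p. 263 [PDF 7], (2.31)
and the sentence after (2.33); [I] = [BalabanImbrieJaffe1985] §7.3 p. 326: **THE HÖLDER MEMBER OF ORDER `1 + θ` OF (2.31) FOR A GENERAL
REGION `Ω ⊇ Ω₀` THAT IS A UNION OF `k`-BLOCKS, HYPOTHESIS-FREE AT SMALL-PLAQUETTE `U(1)` FIELDS** (p. 263: *"for (2.31) we assume smoothness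
throughout the subset Ω ⊂ T_η"*) — the six [6]-inputs of this seat's hypothesis-form theorem
`BIJ88LocDerivHolder231RegionOfInputs.derivHolder231_region_of_inputs_of_smooth` DISCHARGED BY NAME for every `k`-block union `Ω` under the
plaquette smallness `|u(∂p) − 1| ≤ θ_p`, `(L^{2k}θ_p)² ≤ 1/500` alone ([I] p. 326: *"The propagators arising from Δ_k(u_k), under the restriction
(7.3.1) on the gauge field, also satisfy the regularity and decay estimates of [7]"*): (H1)–(H4) by p29 g30's `inputs_smallPlaquette_region`
(p30 g29's `close112_smallPlaquette_region[_deriv]` / `inputs110_smallPlaquette_region` and p34's region members underneath), (H5) by this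
seat's `closeHolder112_smallPlaquette_region` (gen 37, p358926), (H6) by p34 gen 20's `holder19_smallPlaquette_region_H6_of500` (p361864,
`BIJ88NeumannPropagatorSmallFieldRegionHolder` — the region (1.9) Hölder member, delivered in the (H6) binder shape; this seat yielded that
input to p34 on 2026-08-23T10:41Z).  The torus case `Ω = T_η` with lighter imports is this seat's `BIJ88LocDerivHolder231SmallPlaquetteTorus`
(p362001).  With p29 g30's `BIJ88Loc231SmallPlaquetteRegion` (order 1 and order `θ ≤ 1`) EVERY member of the p. 263 sentence *"of order less
than two"* for (2.31) is now in the tree hypothesis-free at small-plaquette fields for every `k`-block region `Ω ⊇ Ω₀`.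

statement-level skeleton of published theorems with citation tags; proofs where landed; nothing here is a claim about the Yang–Mills mass gap

PDFs held: `paper:balaban1988-cmp114-bij-abelian-higgs-effective-action` (p. 263 [PDF 7]); `paper:balaban1985-cmp97-bij-higgs-minimizers`
(p. 326 [PDF 28], (7.3.1) and the propagator sentence); `paper:balaban1983-cmp89-regularity-decay` (p. 573 [PDF 3], Theorem (1.9)–(1.12)).

CITATION HEADER (lean-in-tree rule).  Part of the lit-balaban TYPED SKELETON (HOME `run/shared/lean/pub/lit-balaban/`), PHASE-2 proof seat
p27 gen 38 (unit `lit-balaban-p27-g38`; TAKING #1 line HOME/STATUS.md 2026-08-23T09:15:21Z + ADDENDUM 10:33:06Z (FILE 3b), free-target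
protocol G.5-34(d); p29 g30/g31, r18 g25, p34 g20 no objection — p34 10:34Z: *"NO OBJECTION from p34 to FILE 3b or FILE 2, they are yours"*;
FILE 1a `BIJ88LocDeriv231RegionOfInputsLipschitz` p359923 ACCEPTED, FILE 1b `BIJ88LocDerivHolder231RegionOfInputs` p361019 ACCEPTED, FILE 2
`BIJ88LocDerivHolder231SmallPlaquetteTorus` p362001).  Rows served (LOCATED members, cells only; heads unchanged): **C2.Claim@263** / **C2.Eq2.31**
(owner r18: the H1θ cells of C2S14-CLOSURE §6 «small-plaquette U(1) field | general k-block Ω ⊇ Ω₀» and «actual background u_k | regions» —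
both were OPEN), **C1.Eq7.3.1-7.3.2** (owner r15: located consequence of the p. 326 propagator sentence for `G_{k,loc}`, at small fields and
at `u_k`).  Kind: theorems only (no definition, no `Prop`-valued fact; three
private kernels).  USED BY NAME, nothing restated: this seat's `derivHolder231_region_of_inputs_of_smooth` (FILE 1b),
`closeHolder112_smallPlaquette_region` (`BIJ88NeumannPropagatorSmallFieldCloseHolderRegion`), p29 g30's `inputs_smallPlaquette_region`
(`BIJ88Loc231SmallPlaquetteRegion`), p34 g20's `holder19_smallPlaquette_region_H6_of500` (`BIJ88NeumannPropagatorSmallFieldRegionHolder`), this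
seat's `isBlockUnion_cubeT`, r18's `zetaPi` facts (`BIJ88LocDeriv230ZetaPiFlatTorus`),
`Literature.Analysis.Calculus.exists_abs_deriv_and_deriv_deriv_smoothTransition_le`, p34 gen 19's `smallPlaquette_actualBg`
(`BIJ88NeumannPropagatorActualBackground`), p22's `actualBgU1` (4.5.4).

THE PRINTED TEXT (p. 263 / p. 326, verbatim).  *"|(G_{k,loc}(u)f − G_k(Ω,u)f)(x)| ≦ e^{−cr(e_k)}e^{−c dist(suppt f,x)}‖f‖_∞, (2.31) for dist(x, Ω^c)
≧ O(r(e_k)). … for (2.31) we assume smoothness throughout the subset Ω ⊂ T_η. … Bounds analogous to (2.30), (2.31) hold for covariant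
derivatives and Hölder derivatives of G_{k,loc}(u) of order less than two."* [v-land docfix: an earlier header continued this quotation with «As in [6, 7] we need control over u in order to obtain these
estimates» — NOT a printed sentence (p. 263 text layer `p0007.txt` L27–28 continues «We use G_{k,loc} to define a localized quadratic form for
scalar fields, (2.34)»); it was a READING of the role of (2.32) (*"We assume that u is smooth in the □_α's entering the sum in (2.27); for (2.31)
we assume smoothness throughout the subset Ω ⊂ T_η"*, p. 263 L19–21); observation p34 g22 2026-08-23T16:09Z; declarations untouched]; [I] p. 326: *"|v(∂p) − 1| ≦ e_kμ(e_k) (7.3.1) … The propagators arising from Δ_k(u_k), under the restriction (7.3.1) on the gauge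
field, also satisfy the regularity and decay estimates of [7]."*

WHAT IS PROVED (theorems only; 0 `sorry`; standard axioms).
* §1 **`inputs6_smallPlaquette_region`** — for `1 ≤ d`, `d + 1 ≤ 3`, `ℓ ≥ 1`, `ℓ + 1` odd, `a > 0`, `0 ≤ θ < 1`: `∃ δ₀ c₀ > 0` such that on every
  torus (`P.d = d+1`, `P.L = ℓ+1`), at every `1 ≤ k ≤ K` with `2(L^k−1) + 4 < |T^{(0)}|`, for every `U(1)` field with `|u(∂p) − 1| ≤ θ_p`,
  `0 ≤ θ_p`, `(L^{2k}θ_p)² ≤ 1/500` and EVERY union `Ω` of `k`-blocks (`IsBlockUnion k Ω`), the six hypotheses (H1)–(H6) of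
  `derivHolder231_region_of_inputs_of_smooth` hold for `Ω` with `ρ := 17L^k`, at `(c₀, δ₀)`.
* §2 **`derivHolder231_smallPlaquette_region_of_smooth`** — `∃ δ₀ C > 0` (on `d, ℓ, a, θ, K₁, K₂`): for the same tori, levels, fields and regions
  `Ω`, the reference box `Ω₀ = c·L^k + Π_i[0, L^kM₀_i) ⊆ Ω` shorter than the torus with torus gap `≥ R`, `s ≥ 1`, `R ≥ 18L^k + 3`, `0 ≤ R₁ < R₀`,
  `W ≥ 2s/3 + R₀/2 + R`, every real smooth cut-off `ζ″` (`|ζ″| ≤ 1`, `= 0` beyond `R₀`, `= 1` within `R₁`, `Δζ″ ≤ K₁/(R₀−R₁)`, `Δ²ζ″ ≤ K₂/(R₀−R₁)²`),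
  every `μ`, all `x₁, x₂` with the four bond ends in `Ω₀` at chart depth `≥ R₀ + R`, every `f` (`‖f‖_∞ ≤ F`, support at sup-torus distance
  `≥ D ≥ 0` from `x₁`, `x₂`), with `ψ = G_{k,loc}(u)f − G_k(Ω,u)f`:
  `(L^k/|x₁ − x₂|_T)^θ·‖U(Γ_{x₁,x₂})(D_uψ)(x₂,μ) − (D_uψ)(x₁,μ)‖ ≤ (L^kε)·C·(1 + L^k((R₀−R₁)⁻¹ + s⁻¹))²·[m·e^{−δ₀(2R−1)/L^k} + e^{−(δ₀/2)(R₁−1)/L^k}]·e^{−(δ₀/2)D/L^k}·F`,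
  `m = (⌊(L^k − 1 + R₀)/s⌋ + 3)^{d+1}`, `U(Γ)` = p30's `stairHol u x₁ x₂` (FILE 1b's slack `e^{3δ₀}` absorbed in `C`).
* §3 **`derivHolder231_smallPlaquette_region_zetaPi`** — §2 at r18's `zetaPi R₁ R₀ 0` (`1 ≤ R₁ < R₀ ≤ (|T^{(0)}| − 3)/2`), hypothesis-free in
  the cut-off.
* §4 **`derivHolder231_actualBg_region_of_smooth`** / **`derivHolder231_actualBg_region_zetaPi`** — §2 / §3 AT THE ACTUAL BACKGROUND
  `u_k = actualBgU1 hd2 k e v` of [I] (4.5.4) UNDER THE PRINTED (7.3.1) `|v(∂q) − 1| ≤ e(1 + log e⁻¹)^𝓅` with one threshold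
  `e(1 + log e⁻¹)^𝓅 ≤ 1/(23(d+1)²K)`, `K ≥ 1` p34 gen 19's constant (`smallPlaquette_actualBg`, p359041, BY NAME) — every `k`-block union
  `Ω ⊇ Ω₀`, in particular `Ω = T_η`; p29 g31 (10:33:47Z) and p34 g20 (10:22:51Z) assign these `u_k` members of the H1θ column to this seat.
HONEST SCOPE / DIVERGENCE.  (i) `Ω` must be a union of `k`-blocks containing the reference box `Ω₀` (p31's `IsBlockUnion`; the print's
*"subset Ω ⊂ T_η"* at which smoothness is assumed); nothing is said for other `Ω`.  (ii) The plaquette hypothesis is p30's oriented form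
`‖plaqC u y μ ν − 1‖ ≤ θ_p` on the FINE plaquettes with `(L^{2k}θ_p)² ≤ 1/500`; the passage from the PRINTED (7.3.1) on the unit-lattice field
`v` to this hypothesis for the actual background `u_k` of (4.5.4) is p34 g19's `BIJ88NeumannPropagatorActualBackground.smallPlaquette_actualBg`
(p359041), consumed by name in §4; THE PRINTED (7.3.1) constrains the unit-lattice plaquettes of `v` — §4 takes exactly that hypothesis plus
ONE smallness threshold on `e_k𝓅(e_k)` (the print's "e_k sufficiently small"); the exponent `𝓅` is a free parameter (print: `μ(e_k)`).  (iii) DEEP BONDS ONLY (chart depth `≥ R₀ + R` in `Ω₀`, `R ≥ 18L^k + 3`: (H5)'s pairs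
are `17L^k`-deep, (H6)'s `3L^k`-deep); `d + 1 ∈ {2,3}`, `L` odd `≥ 2`; transport `stairHol`; smooth cut-offs only.  (iv) Constants existential
(`δ₀ = min`, `c₀ = max` of the providers'), not optimized.  `set_option maxHeartbeats 800000` on §1–§3 (long statements).  DIVERGENCE OF
METHOD as in every file of this lane (perturbative small-field estimates in place of [6]'s random walk).  Imports: FILE 1b, p29 g30
`BIJ88Loc231SmallPlaquetteRegion`, this seat's `BIJ88NeumannPropagatorSmallFieldCloseHolderRegion`, p34 g20's
`BIJ88NeumannPropagatorSmallFieldRegionHolder`.  Literature + Mathlib only.  Unit `lit-balaban-p27` (literature-prover-lit-balaban-p27-g38-0),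
HOME `run/shared/lean/pub/lit-balaban/`, 2026-08-23.  NOT summit progress, continuum or Clay.
-/

open scoped BigOperators Matrix ComplexConjugate
open Finset Matrix

namespace Literature.MathematicalPhysics.QuantumFieldTheory.BalabanImbrieJaffe1984to88.BIJ88LocDerivHolder231SmallPlaquetteRegion

open Literature.MathematicalPhysics.QuantumFieldTheory.Balaban1983to89
open BIJ88Sect3Statements (U1 toC cfg covD)
open BIJ85BlockAveragesTorus BIJ85BlockAveragesTorusK
open BIJ88NeumannPropagator227Torus (gBox)
open BIJ88DeltaLoc234Torus (gLocT)
open BIJ88NeumannPropagatorFlatDecayCube (cubeT boxCoord isBlockUnion_cubeT)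
open BIJ88LocWeights227Torus
open BIJ85AbelianStokes (plaqC)
open BIJ88NeumannNoZeroModesTorus (IsBlockUnion)
open BIJ88Loc231SmallPlaquetteRegion (inputs_smallPlaquette_region)
open BIJ88NeumannPropagatorSmallFieldCloseHolderRegion (closeHolder112_smallPlaquette_region)
open BIJ85ScalarPropagatorHolderDecay (stairHol)
open BIJ88NeumannPropagatorSmallFieldRegionHolder (holder19_smallPlaquette_region_H6_of500)
open BIJ88LocDerivHolder231RegionOfInputs (derivHolder231_region_of_inputs_of_smooth)

noncomputable section

variable {d : ℕ} {P : Params}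

/-- kernel: `e^{−δ'E} ≤ e^{−δE}` for `δ ≤ δ'`, `E ≥ 0`. [folklore] -/
private theorem exp_le_exp_of_rate {δ δ' E : ℝ} (hδ : δ ≤ δ') (hE : 0 ≤ E) : Real.exp (-(δ' * E)) ≤ Real.exp (-(δ * E)) :=
  Real.exp_le_exp.2 (neg_le_neg (mul_le_mul_of_nonneg_right hδ hE))

/-- kernel: monotonicity of a bound `c·e^{−δE}·F` in the constant and the rate. [folklore] -/
private theorem bound_mono {c C δ Δ E F : ℝ} (hc : 0 ≤ c) (hcC : c ≤ C) (hΔ : Δ ≤ δ) (hE : 0 ≤ E) (hF : 0 ≤ F) :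
    c * Real.exp (-(δ * E)) * F ≤ C * Real.exp (-(Δ * E)) * F :=
  mul_le_mul_of_nonneg_right (mul_le_mul hcC (exp_le_exp_of_rate hΔ hE) (Real.exp_pos _).le (hc.trans hcC)) hF

/-- kernel: the same with the (1.12) bracket. [folklore] -/
private theorem bound_mono₂ {c C δ Δ E E' F : ℝ} (hc : 0 ≤ c) (hcC : c ≤ C) (hΔ : Δ ≤ δ) (hE : 0 ≤ E) (hE' : 0 ≤ E') (hF : 0 ≤ F) :
    c * Real.exp (-(δ * E)) * Real.exp (-(δ * E')) * F ≤ C * Real.exp (-(Δ * E)) * Real.exp (-(Δ * E')) * F :=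
  mul_le_mul_of_nonneg_right (mul_le_mul (mul_le_mul hcC (exp_le_exp_of_rate hΔ hE) (Real.exp_pos _).le (hc.trans hcC))
    (exp_le_exp_of_rate hΔ hE') (Real.exp_pos _).le (mul_nonneg (hc.trans hcC) (Real.exp_pos _).le)) hF

/-! ## §1 The six [6]-inputs for a union `Ω` of `k`-blocks at small plaquette fields, at one pair of constants -/

set_option maxHeartbeats 800000 in
/-- **THE SIX [6]-INPUTS OF `derivHolder231_region_of_inputs_of_smooth` FOR A UNION `Ω` OF `k`-BLOCKS AT SMALL PLAQUETTE FIELDS, AT ONE PAIR OF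
CONSTANTS, DEPTH `ρ = 17L^k`** ([BalabanImbrieJaffe1985] p. 326 (7.3.1) and *"The propagators arising from Δ_k(u_k), under the restriction
(7.3.1) on the gauge field, also satisfy the regularity and decay estimates of [7]"*; [6] = [Balaban1983RegularityDecay] Theorem p. 573
(1.9)–(1.12)): for `1 ≤ d`, `d + 1 ≤ 3`, `ℓ ≥ 1`, `ℓ + 1` odd, `a > 0`, `0 ≤ θ < 1` THERE ARE `δ₀, c₀ > 0` (on `d, ℓ, a, θ`) such that on every
torus (`P.d = d+1`, `P.L = ℓ+1`), at every `1 ≤ k ≤ K` with `2(L^k−1) + 4 < |T^{(0)}|`, for every field with `|u(∂p) − 1| ≤ θ_p`, `0 ≤ θ_p`,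
`(L^{2k}θ_p)² ≤ 1/500`, every `k`-block union `Ω`: (H1)–(H4) = p29 g30's `inputs_smallPlaquette_region` (p30 g29 p358281 / p34, depth `L^k` weakened to
`17L^k`), (H5) = this seat's `closeHolder112_smallPlaquette_region` (p358926) for the fitting cubes `□ ⊆ Ω`, (H6) = p34 gen 20's
`holder19_smallPlaquette_region_H6_of500` (p361864; depth `3L^k` weakened to `17L^k`) — all six at `(c₀, δ₀)`, in the binder shapes of
`derivHolder231_region_of_inputs_of_smooth` at the region `Ω`, `ρ := 17L^k`.
[cite: BalabanImbrieJaffe1985, (7.3.1) p.326] [cite: Balaban1983RegularityDecay, Theorem p.573 (1.9)–(1.12)] [cite: BalabanImbrieJaffe1988, (2.31) p.263] -/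
theorem inputs6_smallPlaquette_region (d ℓ : ℕ) (hd1 : 1 ≤ d) (hd3 : d + 1 ≤ 3) (hℓ : 1 ≤ ℓ) (hodd : Odd (ℓ + 1)) {a : ℝ} (ha : 0 < a)
    {θ : ℝ} (hθ0 : 0 ≤ θ) (hθ1 : θ < 1) :
    ∃ δ₀ c₀ : ℝ, 0 < δ₀ ∧ 0 < c₀ ∧ ∀ (P : Params) (hPd : P.d = d + 1), P.L = ℓ + 1 →
      ∀ (k : ℕ), 1 ≤ k → k ≤ P.K → 2 * (P.L ^ k - 1) + 4 < P.sitesPerDir 0 →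
      ∀ (U : GaugeField P 0 U1) (θp : ℝ), 0 ≤ θp → (∀ (y : Balaban1983to89.Site P 0) (μ ν : Fin P.d), ‖plaqC U y μ ν - 1‖ ≤ θp) →
        (((P.L : ℝ) ^ k) ^ 2 * θp) ^ 2 ≤ 1 / 500 →
      ∀ (Ω : Finset (Balaban1983to89.Site P 0)), IsBlockUnion k Ω →
      -- (H1) the (1.11)–(1.12) covariant-derivative closeness member for the fitting no-wrap cubes `□ ⊆ Ω`
      (∀ (c' M' : Fin (d + 1) → ℕ), (∀ i, 1 ≤ M' i) → (∀ i, c' i * P.L ^ k + P.L ^ k * M' i ≤ P.sitesPerDir 0) →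
          (∀ i, P.L ^ k * M' i < P.sitesPerDir 0) → (cubeT hPd (P.L ^ k) c' fun i => P.L ^ k * M' i) ⊆ Ω →
        ∀ (x : Balaban1983to89.Site P 0) (μ : Fin P.d), x ∈ (cubeT hPd (P.L ^ k) c' fun i => P.L ^ k * M' i) →
          x.shift μ ∈ (cubeT hPd (P.L ^ k) c' fun i => P.L ^ k * M' i) →
          (∀ w, w ∉ (cubeT hPd (P.L ^ k) c' fun i => P.L ^ k * M' i) → 17 * (P.L : ℝ) ^ k ≤ B5Ineq137Torus.T P 0 x w) →
        ∀ (g : Balaban1983to89.Site P 0 → ℂ) (F D Db Df : ℝ), (∀ y, ‖g y‖ ≤ F) →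
          (∀ y, y ∉ (cubeT hPd (P.L ^ k) c' fun i => P.L ^ k * M' i) → g y = 0) →
          0 ≤ D → (∀ y, g y ≠ 0 → D ≤ B5Ineq137Torus.T P 0 x y) →
          0 ≤ Db → (∀ w, w ∉ (cubeT hPd (P.L ^ k) c' fun i => P.L ^ k * M' i) → Db ≤ B5Ineq137Torus.T P 0 x w) →
          0 ≤ Df → (∀ y, g y ≠ 0 → ∀ w, w ∉ (cubeT hPd (P.L ^ k) c' fun i => P.L ^ k * M' i) → Df ≤ B5Ineq137Torus.T P 0 y w) →
          ‖covD P.eps⁻¹ (cfg U) (gBox (B1RG242Torus.α P a k * (P.L : ℝ) ^ (k * P.d)) P.eps⁻¹ U k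
                  (cubeT hPd (P.L ^ k) c' fun i => P.L ^ k * M' i) *ᵥ g) ⟨x, μ⟩ -
              covD P.eps⁻¹ (cfg U) (gBox (B1RG242Torus.α P a k * (P.L : ℝ) ^ (k * P.d)) P.eps⁻¹ U k Ω *ᵥ g) ⟨x, μ⟩‖ ≤
            P.spacing k * (c₀ * Real.exp (-(δ₀ * (((P.L : ℝ) ^ k)⁻¹ * D))) * Real.exp (-(δ₀ * (((P.L : ℝ) ^ k)⁻¹ * (Db + Df)))) * F)) ∧
      -- (H2) the (1.11)–(1.12) value closeness member for the same cubes and rows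
      (∀ (c' M' : Fin (d + 1) → ℕ), (∀ i, 1 ≤ M' i) → (∀ i, c' i * P.L ^ k + P.L ^ k * M' i ≤ P.sitesPerDir 0) →
          (∀ i, P.L ^ k * M' i < P.sitesPerDir 0) → (cubeT hPd (P.L ^ k) c' fun i => P.L ^ k * M' i) ⊆ Ω →
        ∀ (x : Balaban1983to89.Site P 0), x ∈ (cubeT hPd (P.L ^ k) c' fun i => P.L ^ k * M' i) →
          (∀ w, w ∉ (cubeT hPd (P.L ^ k) c' fun i => P.L ^ k * M' i) → 17 * (P.L : ℝ) ^ k ≤ B5Ineq137Torus.T P 0 x w) →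
        ∀ (g : Balaban1983to89.Site P 0 → ℂ) (F D Db Df : ℝ), (∀ y, ‖g y‖ ≤ F) →
          (∀ y, y ∉ (cubeT hPd (P.L ^ k) c' fun i => P.L ^ k * M' i) → g y = 0) →
          0 ≤ D → (∀ y, g y ≠ 0 → D ≤ B5Ineq137Torus.T P 0 x y) →
          0 ≤ Db → (∀ w, w ∉ (cubeT hPd (P.L ^ k) c' fun i => P.L ^ k * M' i) → Db ≤ B5Ineq137Torus.T P 0 x w) →
          0 ≤ Df → (∀ y, g y ≠ 0 → ∀ w, w ∉ (cubeT hPd (P.L ^ k) c' fun i => P.L ^ k * M' i) → Df ≤ B5Ineq137Torus.T P 0 y w) →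
          ‖(gBox (B1RG242Torus.α P a k * (P.L : ℝ) ^ (k * P.d)) P.eps⁻¹ U k (cubeT hPd (P.L ^ k) c' fun i => P.L ^ k * M' i) *ᵥ g) x -
              (gBox (B1RG242Torus.α P a k * (P.L : ℝ) ^ (k * P.d)) P.eps⁻¹ U k Ω *ᵥ g) x‖ ≤
            P.spacing k ^ 2 * (c₀ * Real.exp (-(δ₀ * (((P.L : ℝ) ^ k)⁻¹ * D))) * Real.exp (-(δ₀ * (((P.L : ℝ) ^ k)⁻¹ * (Db + Df)))) * F)) ∧
      -- (H3) the (1.10) covariant-derivative member of `G_k(Ω,u)` at the `17L^k`-deep rows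
      (∀ (x : Balaban1983to89.Site P 0), x ∈ Ω → (∀ w, w ∉ Ω → 17 * (P.L : ℝ) ^ k ≤ B5Ineq137Torus.T P 0 x w) →
        ∀ (μ : Fin P.d) (g : Balaban1983to89.Site P 0 → ℂ) (F D : ℝ), (∀ y, ‖g y‖ ≤ F) → 0 ≤ D →
          (∀ y, g y ≠ 0 → D ≤ B5Ineq137Torus.T P 0 x y) →
          ‖covD P.eps⁻¹ (cfg U) (gBox (B1RG242Torus.α P a k * (P.L : ℝ) ^ (k * P.d)) P.eps⁻¹ U k Ω *ᵥ g) ⟨x, μ⟩‖ ≤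
            P.spacing k * (c₀ * Real.exp (-(δ₀ * (((P.L : ℝ) ^ k)⁻¹ * D))) * F)) ∧
      -- (H4) the (1.10) value member of `G_k(Ω,u)` at the `17L^k`-deep rows
      (∀ (x : Balaban1983to89.Site P 0), x ∈ Ω → (∀ w, w ∉ Ω → 17 * (P.L : ℝ) ^ k ≤ B5Ineq137Torus.T P 0 x w) →
        ∀ (g : Balaban1983to89.Site P 0 → ℂ) (F D : ℝ), (∀ y, ‖g y‖ ≤ F) → 0 ≤ D →
          (∀ y, g y ≠ 0 → D ≤ B5Ineq137Torus.T P 0 x y) →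
          ‖(gBox (B1RG242Torus.α P a k * (P.L : ℝ) ^ (k * P.d)) P.eps⁻¹ U k Ω *ᵥ g) x‖ ≤
            P.spacing k ^ 2 * (c₀ * Real.exp (-(δ₀ * (((P.L : ℝ) ^ k)⁻¹ * D))) * F)) ∧
      -- (H5) the (1.11)–(1.12) Hölder-of-`D_u` closeness member for the fitting no-wrap cubes `□ ⊆ Ω` at pairs of distinct `17L^k`-deep rows
      (∀ (c' M' : Fin (d + 1) → ℕ), (∀ i, 1 ≤ M' i) → (∀ i, c' i * P.L ^ k + P.L ^ k * M' i ≤ P.sitesPerDir 0) →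
          (∀ i, P.L ^ k * M' i < P.sitesPerDir 0) → (cubeT hPd (P.L ^ k) c' fun i => P.L ^ k * M' i) ⊆ Ω →
        ∀ (x₁ x₂ : Balaban1983to89.Site P 0) (μ : Fin P.d), x₁ ≠ x₂ → x₁ ∈ (cubeT hPd (P.L ^ k) c' fun i => P.L ^ k * M' i) → x₂ ∈ (cubeT hPd (P.L ^ k) c' fun i => P.L ^ k * M' i) →
          (∀ w, w ∉ (cubeT hPd (P.L ^ k) c' fun i => P.L ^ k * M' i) → 17 * (P.L : ℝ) ^ k ≤ B5Ineq137Torus.T P 0 x₁ w) →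
          (∀ w, w ∉ (cubeT hPd (P.L ^ k) c' fun i => P.L ^ k * M' i) → 17 * (P.L : ℝ) ^ k ≤ B5Ineq137Torus.T P 0 x₂ w) →
        ∀ (g : Balaban1983to89.Site P 0 → ℂ) (F D Db Df : ℝ), (∀ y, ‖g y‖ ≤ F) →
          (∀ y, y ∉ (cubeT hPd (P.L ^ k) c' fun i => P.L ^ k * M' i) → g y = 0) →
          0 ≤ D → (∀ y, g y ≠ 0 → D ≤ B5Ineq137Torus.T P 0 x₁ y) → (∀ y, g y ≠ 0 → D ≤ B5Ineq137Torus.T P 0 x₂ y) →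
          0 ≤ Db → (∀ w, w ∉ (cubeT hPd (P.L ^ k) c' fun i => P.L ^ k * M' i) → Db ≤ B5Ineq137Torus.T P 0 x₁ w) →
          (∀ w, w ∉ (cubeT hPd (P.L ^ k) c' fun i => P.L ^ k * M' i) → Db ≤ B5Ineq137Torus.T P 0 x₂ w) →
          0 ≤ Df → (∀ y, g y ≠ 0 → ∀ w, w ∉ (cubeT hPd (P.L ^ k) c' fun i => P.L ^ k * M' i) → Df ≤ B5Ineq137Torus.T P 0 y w) →
          ((P.L : ℝ) ^ k / B5Ineq137Torus.T P 0 x₁ x₂) ^ θ *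
              ‖stairHol U x₁ x₂ *
                  covD P.eps⁻¹ (cfg U) (gBox (B1RG242Torus.α P a k * (P.L : ℝ) ^ (k * P.d)) P.eps⁻¹ U k (cubeT hPd (P.L ^ k) c' fun i => P.L ^ k * M' i) *ᵥ g -
                    gBox (B1RG242Torus.α P a k * (P.L : ℝ) ^ (k * P.d)) P.eps⁻¹ U k Ω *ᵥ g) ⟨x₂, μ⟩ -
                covD P.eps⁻¹ (cfg U) (gBox (B1RG242Torus.α P a k * (P.L : ℝ) ^ (k * P.d)) P.eps⁻¹ U k (cubeT hPd (P.L ^ k) c' fun i => P.L ^ k * M' i) *ᵥ g -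
                    gBox (B1RG242Torus.α P a k * (P.L : ℝ) ^ (k * P.d)) P.eps⁻¹ U k Ω *ᵥ g) ⟨x₁, μ⟩‖ ≤
            P.spacing k * (c₀ * Real.exp (-(δ₀ * (((P.L : ℝ) ^ k)⁻¹ * D))) * Real.exp (-(δ₀ * (((P.L : ℝ) ^ k)⁻¹ * (Db + Df)))) * F)) ∧
      -- (H6) the (1.9) Hölder-of-`D_u` member of `G_k(Ω,u)` at pairs of distinct `17L^k`-deep rows
      (∀ (x₁ x₂ : Balaban1983to89.Site P 0) (μ : Fin P.d), x₁ ≠ x₂ → x₁ ∈ Ω → x₂ ∈ Ω →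
          (∀ w, w ∉ Ω → 17 * (P.L : ℝ) ^ k ≤ B5Ineq137Torus.T P 0 x₁ w) → (∀ w, w ∉ Ω → 17 * (P.L : ℝ) ^ k ≤ B5Ineq137Torus.T P 0 x₂ w) →
        ∀ (g : Balaban1983to89.Site P 0 → ℂ) (F D : ℝ), (∀ y, ‖g y‖ ≤ F) → 0 ≤ D →
          (∀ y, g y ≠ 0 → D ≤ B5Ineq137Torus.T P 0 x₁ y) → (∀ y, g y ≠ 0 → D ≤ B5Ineq137Torus.T P 0 x₂ y) →
          ((P.L : ℝ) ^ k / B5Ineq137Torus.T P 0 x₁ x₂) ^ θ *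
              ‖stairHol U x₁ x₂ * covD P.eps⁻¹ (cfg U) (gBox (B1RG242Torus.α P a k * (P.L : ℝ) ^ (k * P.d)) P.eps⁻¹ U k Ω *ᵥ g) ⟨x₂, μ⟩ -
                covD P.eps⁻¹ (cfg U) (gBox (B1RG242Torus.α P a k * (P.L : ℝ) ^ (k * P.d)) P.eps⁻¹ U k Ω *ᵥ g) ⟨x₁, μ⟩‖ ≤
            P.spacing k * (c₀ * Real.exp (-(δ₀ * (((P.L : ℝ) ^ k)⁻¹ * D))) * F)) := by
  obtain ⟨δa, ca, hδa, hca, HA⟩ := inputs_smallPlaquette_region d ℓ hd1 hd3 hℓ hodd ha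
  obtain ⟨c₃, δ₃, hc₃, hδ₃, H5p⟩ := closeHolder112_smallPlaquette_region d ℓ hd1 hd3 hℓ hodd ha hθ0 hθ1
  obtain ⟨t₀, cH, ht₀, hcH, H6p⟩ := holder19_smallPlaquette_region_H6_of500 d ℓ hd1 hd3 hℓ hodd ha hθ0 hθ1
  -- the common constants
  set δ₀ : ℝ := min δa (min δ₃ t₀) with hδ₀def
  set c₀ : ℝ := max ca (max c₃ cH) with hc₀def
  have hδ₀ : 0 < δ₀ := lt_min hδa (lt_min hδ₃ ht₀)
  have hc₀ : 0 < c₀ := lt_max_of_lt_left hca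
  have hca0 : ca ≤ c₀ := le_max_left _ _
  have hc30 : c₃ ≤ c₀ := (le_max_left _ _).trans (le_max_right _ _)
  have hcH0 : cH ≤ c₀ := (le_max_right _ _).trans (le_max_right _ _)
  have hδa0 : δ₀ ≤ δa := min_le_left _ _
  have hδ30 : δ₀ ≤ δ₃ := (min_le_right _ _).trans (min_le_left _ _)
  have hδH0 : δ₀ ≤ t₀ := (min_le_right _ _).trans (min_le_right _ _)
  refine ⟨δ₀, c₀, hδ₀, hc₀, ?_⟩
  intro P hPd hPL k hk1 hkK hbig U θp hθp0 hplaq hsm Ω hΩ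
  have hkm : k ≤ P.m + P.K := hkK.trans (Nat.le_add_left _ _)
  have hPk : (0 : ℝ) < (P.L : ℝ) ^ k := pow_pos P.cast_L_pos k
  have hPkinv : 0 ≤ ((P.L : ℝ) ^ k)⁻¹ := (inv_pos.2 hPk).le
  have hsk : 0 < P.spacing k := P.spacing_pos k
  have hsk2 : 0 ≤ P.spacing k ^ 2 := by positivity
  obtain ⟨H1p, H2p, H3p, H4p⟩ := HA P hPd hPL k hk1 hkK hbig U θp hθp0 hplaq hsm Ω hΩ
  -- depth `17L^k` implies depth `L^k`
  have h17 : ∀ {x w : Balaban1983to89.Site P 0}, 17 * (P.L : ℝ) ^ k ≤ B5Ineq137Torus.T P 0 x w → (P.L : ℝ) ^ k ≤ B5Ineq137Torus.T P 0 x w :=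
    fun h => le_trans (by linarith) h
  refine ⟨?_, ?_, ?_, ?_, ?_, ?_⟩
  · -- (H1)
    intro c' M' hM' hfit' hN' hsub x μ hx hxe hρx g F D Db Df hF hsuppg hD hsD hDb hsDb hDf hsDf
    have hF0 : 0 ≤ F := (norm_nonneg _).trans (hF x)
    exact (H1p c' M' hM' hfit' hN' hsub x μ hx hxe (fun w hw => h17 (hρx w hw)) g F D Db Df hF hsuppg hD hsD hDb hsDb hDf hsDf).trans
      (mul_le_mul_of_nonneg_left
        (bound_mono₂ hca.le hca0 hδa0 (mul_nonneg hPkinv hD) (mul_nonneg hPkinv (add_nonneg hDb hDf)) hF0) hsk.le)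
  · -- (H2)
    intro c' M' hM' hfit' hN' hsub x hx hρx g F D Db Df hF hsuppg hD hsD hDb hsDb hDf hsDf
    have hF0 : 0 ≤ F := (norm_nonneg _).trans (hF x)
    exact (H2p c' M' hM' hfit' hN' hsub x hx (fun w hw => h17 (hρx w hw)) g F D Db Df hF hsuppg hD hsD hDb hsDb hDf hsDf).trans
      (mul_le_mul_of_nonneg_left
        (bound_mono₂ hca.le hca0 hδa0 (mul_nonneg hPkinv hD) (mul_nonneg hPkinv (add_nonneg hDb hDf)) hF0) hsk2)
  · -- (H3)
    intro x hx hρ μ g F D hF hD hsupp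
    have hF0 : 0 ≤ F := (norm_nonneg _).trans (hF x)
    exact (H3p x hx (fun w hw => h17 (hρ w hw)) μ g F D hF hD hsupp).trans
      (mul_le_mul_of_nonneg_left (bound_mono hca.le hca0 hδa0 (mul_nonneg hPkinv hD) hF0) hsk.le)
  · -- (H4)
    intro x hx hρ g F D hF hD hsupp
    have hF0 : 0 ≤ F := (norm_nonneg _).trans (hF x)
    exact (H4p x hx (fun w hw => h17 (hρ w hw)) g F D hF hD hsupp).trans
      (mul_le_mul_of_nonneg_left (bound_mono hca.le hca0 hδa0 (mul_nonneg hPkinv hD) hF0) hsk2)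
  · -- (H5): this seat's region Hölder `δG` member with `□ = cubeT c' M' ⊆ Ω`
    intro c' M' hM' hfit' hN' hsub x₁ x₂ μ hne hx₁ hx₂ hρ₁ hρ₂ g F D Db Df hF hsuppg hD hsD₁ hsD₂ hDb hsDb₁ hsDb₂ hDf hsDf
    have hF0 : 0 ≤ F := (norm_nonneg _).trans (hF x₁)
    have hBU : IsBlockUnion k (cubeT hPd (P.L ^ k) c' fun i => P.L ^ k * M' i) := isBlockUnion_cubeT hPd hkm rfl hfit'
    have key := H5p P hPd hPL k hk1 hkK hbig U θp hθp0 hplaq hsm _ Ω hBU hΩ hsub x₁ x₂ μ hne hx₁ hx₂ hρ₁ hρ₂ g F D Db Df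
      hF hsuppg hD hsD₁ hsD₂ hDb hsDb₁ hsDb₂ hDf hsDf
    exact key.trans (mul_le_mul_of_nonneg_left
      (bound_mono₂ hc₃.le hc30 hδ30 (mul_nonneg hPkinv hD) (mul_nonneg hPkinv (add_nonneg hDb hDf)) hF0) hsk.le)
  · -- (H6): p34 g20's region Hölder member (1.9) at small plaquette fields (depth `3L^k` weakened to `17L^k`)
    intro x₁ x₂ μ hne hx₁ hx₂ hρ₁ hρ₂ g F D hF hD hsD₁ hsD₂
    have hF0 : 0 ≤ F := (norm_nonneg _).trans (hF x₁)
    have h317 : 3 * (P.L : ℝ) ^ k ≤ 17 * (P.L : ℝ) ^ k := by linarith [hPk.le]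
    have key := H6p P hPd hPL k hk1 hkK hbig U θp hθp0 hplaq hsm Ω hΩ (17 * (P.L : ℝ) ^ k) h317 x₁ x₂ μ hne hx₁ hx₂ hρ₁ hρ₂ g F D hF hD
      hsD₁ hsD₂
    exact key.trans (mul_le_mul_of_nonneg_left (bound_mono hcH.le hcH0 hδH0 (mul_nonneg hPkinv hD) hF0) hsk.le)

/-! ## §2 The Hölder member of order `1 + θ` of (2.31) for a `k`-block region `Ω ⊇ Ω₀`, hypothesis-free at small plaquette fields -/

set_option maxHeartbeats 800000 in
/-- **THE HÖLDER MEMBER OF ORDER `1 + θ` (`0 ≤ θ < 1`) OF (2.31) FOR A `k`-BLOCK REGION `Ω ⊇ Ω₀`, HYPOTHESIS-FREE AT SMALL-PLAQUETTE `U(1)`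
FIELDS** (p. 263: *"Bounds analogous to (2.30), (2.31) hold for covariant derivatives and Hölder derivatives of G_{k,loc}(u) of order less
than two"*; [I] p. 326: *"The propagators arising from Δ_k(u_k), under the restriction (7.3.1) on the gauge field, also satisfy the regularity
and decay estimates of [7]"*; p. 263: *"for (2.31) we assume smoothness throughout the subset Ω ⊂ T_η"*): this seat's hypothesis-form
`derivHolder231_region_of_inputs_of_smooth` at a union `Ω` of `k`-blocks containing `Ω₀`, `ρ = 17L^k`, its six
inputs discharged by §1; the slack `e^{3δ₀}` absorbed in the constant.  For every torus of the series (`P.d = d+1 ∈ {2,3}`, `P.L = ℓ+1` odd),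
every `1 ≤ k ≤ K` with `2(L^k−1) + 4 < |T^{(0)}|`, every `U(1)` field with `|u(∂p) − 1| ≤ θ_p`, `0 ≤ θ_p`, `(L^{2k}θ_p)² ≤ 1/500`, every
reference box `Ω₀ ⊆ Ω` (torus gap `≥ R`), `s ≥ 1`, `R ≥ 18L^k + 3`, `0 ≤ R₁ < R₀`, `W ≥ 2s/3 + R₀/2 + R`, every smooth cut-off `ζ″` (`K₁`, `K₂`),
every `μ`, all `x₁, x₂` with the four bond ends at chart depth `≥ R₀ + R`, every `f` supported at distance `≥ D ≥ 0` from `x₁`, `x₂`: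
`(L^k/|x₁ − x₂|_T)^θ·‖stairHol u x₁ x₂·(D_uψ)(x₂,μ) − (D_uψ)(x₁,μ)‖ ≤ (L^kε)·C·(1 + L^k((R₀−R₁)⁻¹ + s⁻¹))²·[m·e^{−δ₀(2R−1)/L^k} +
e^{−(δ₀/2)(R₁−1)/L^k}]·e^{−(δ₀/2)D/L^k}·F`, `ψ = G_{k,loc}(u)f − G_k(Ω,u)f`.
[cite: BalabanImbrieJaffe1988, (2.31) p.263] [cite: BalabanImbrieJaffe1985, (7.3.1) p.326] [cite: Balaban1983RegularityDecay, Theorem p.573 (1.9), (1.11)–(1.12)] -/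
theorem derivHolder231_smallPlaquette_region_of_smooth (d ℓ : ℕ) (hd1 : 1 ≤ d) (hd3 : d + 1 ≤ 3) (hℓ : 1 ≤ ℓ) (hodd : Odd (ℓ + 1))
    {a : ℝ} (ha : 0 < a) {θ : ℝ} (hθ0 : 0 ≤ θ) (hθ1 : θ < 1) {K₁ K₂ : ℝ} (hK₁ : 0 ≤ K₁) (hK₂ : 0 ≤ K₂) :
    ∃ δ₀ C : ℝ, 0 < δ₀ ∧ 0 < C ∧ ∀ (P : Params) (hPd : P.d = d + 1), P.L = ℓ + 1 →
      ∀ (k : ℕ), 1 ≤ k → k ≤ P.K → 2 * (P.L ^ k - 1) + 4 < P.sitesPerDir 0 →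
      ∀ (U : GaugeField P 0 U1) (θp : ℝ), 0 ≤ θp → (∀ (y : Balaban1983to89.Site P 0) (μ ν : Fin P.d), ‖plaqC U y μ ν - 1‖ ≤ θp) →
        (((P.L : ℝ) ^ k) ^ 2 * θp) ^ 2 ≤ 1 / 500 →
      ∀ (Ω : Finset (Balaban1983to89.Site P 0)), IsBlockUnion k Ω →
      ∀ (c M0 : Fin (d + 1) → ℕ), (∀ i, 1 ≤ M0 i) →
        (∀ i, c i * P.L ^ k + P.L ^ k * M0 i ≤ P.sitesPerDir 0) → (∀ i, P.L ^ k * M0 i < P.sitesPerDir 0) →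
        (cubeT hPd (P.L ^ k) c fun i => P.L ^ k * M0 i) ⊆ Ω →
      ∀ (s W : ℕ), 1 ≤ s → ∀ (R R₀ R₁ : ℝ), 18 * (P.L : ℝ) ^ k + 3 ≤ R → 0 ≤ R₁ → R₁ < R₀ → 2 * (s : ℝ) / 3 + R₀ / 2 + R ≤ W →
        (∀ i, ((P.L ^ k * M0 i : ℕ) : ℝ) + R ≤ P.sitesPerDir 0) →
      ∀ (ζ : Balaban1983to89.Site P 0 → Balaban1983to89.Site P 0 → ℝ), (∀ x y, |ζ x y| ≤ 1) →
        (∀ x y, R₀ ≤ B5Ineq137Torus.T P 0 x y → ζ x y = 0) → (∀ x y, B5Ineq137Torus.T P 0 x y ≤ R₁ → ζ x y = 1) →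
        (∀ (x y : Balaban1983to89.Site P 0) (ν : Fin P.d), |ζ (x.shift ν) y - ζ x y| ≤ K₁ / (R₀ - R₁)) →
        (∀ (x y : Balaban1983to89.Site P 0) (κ ν : Fin P.d),
          |ζ ((x.shift ν).shift κ) y - ζ (x.shift ν) y - ζ (x.shift κ) y + ζ x y| ≤ K₂ / (R₀ - R₁) ^ 2) →
      ∀ (x₁ x₂ : Balaban1983to89.Site P 0) (μ : Fin P.d),
        x₁ ∈ (cubeT hPd (P.L ^ k) c fun i => P.L ^ k * M0 i) →
        (∀ i, R₀ + R ≤ (boxCoord hPd (P.L ^ k) c x₁ i : ℝ) ∧ (boxCoord hPd (P.L ^ k) c x₁ i : ℝ) + (R₀ + R) ≤ (P.L ^ k * M0 i : ℕ) - 1) →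
        x₁.shift μ ∈ (cubeT hPd (P.L ^ k) c fun i => P.L ^ k * M0 i) →
        (∀ i, R₀ + R ≤ (boxCoord hPd (P.L ^ k) c (x₁.shift μ) i : ℝ) ∧
          (boxCoord hPd (P.L ^ k) c (x₁.shift μ) i : ℝ) + (R₀ + R) ≤ (P.L ^ k * M0 i : ℕ) - 1) →
        x₂ ∈ (cubeT hPd (P.L ^ k) c fun i => P.L ^ k * M0 i) →
        (∀ i, R₀ + R ≤ (boxCoord hPd (P.L ^ k) c x₂ i : ℝ) ∧ (boxCoord hPd (P.L ^ k) c x₂ i : ℝ) + (R₀ + R) ≤ (P.L ^ k * M0 i : ℕ) - 1) →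
        x₂.shift μ ∈ (cubeT hPd (P.L ^ k) c fun i => P.L ^ k * M0 i) →
        (∀ i, R₀ + R ≤ (boxCoord hPd (P.L ^ k) c (x₂.shift μ) i : ℝ) ∧
          (boxCoord hPd (P.L ^ k) c (x₂.shift μ) i : ℝ) + (R₀ + R) ≤ (P.L ^ k * M0 i : ℕ) - 1) →
      ∀ (f : Balaban1983to89.Site P 0 → ℂ) (F D : ℝ), (∀ y, ‖f y‖ ≤ F) → 0 ≤ D →
        (∀ y, f y ≠ 0 → D ≤ B5Ineq137Torus.T P 0 x₁ y) → (∀ y, f y ≠ 0 → D ≤ B5Ineq137Torus.T P 0 x₂ y) →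
        ((P.L : ℝ) ^ k / B5Ineq137Torus.T P 0 x₁ x₂) ^ θ *
          ‖stairHol U x₁ x₂ *
              (covD P.eps⁻¹ (cfg U)
                  (gLocT (B1RG242Torus.α P a k * (P.L : ℝ) ^ (k * P.d)) P.eps⁻¹ U k
                    (cubeFam hPd (P.L ^ k) c M0 s W) (lamFam hPd (P.L ^ k) c M0 s) ζ *ᵥ f) ⟨x₂, μ⟩ -
                covD P.eps⁻¹ (cfg U) (gBox (B1RG242Torus.α P a k * (P.L : ℝ) ^ (k * P.d)) P.eps⁻¹ U k Ω *ᵥ f) ⟨x₂, μ⟩) -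
            (covD P.eps⁻¹ (cfg U)
                (gLocT (B1RG242Torus.α P a k * (P.L : ℝ) ^ (k * P.d)) P.eps⁻¹ U k
                  (cubeFam hPd (P.L ^ k) c M0 s W) (lamFam hPd (P.L ^ k) c M0 s) ζ *ᵥ f) ⟨x₁, μ⟩ -
              covD P.eps⁻¹ (cfg U) (gBox (B1RG242Torus.α P a k * (P.L : ℝ) ^ (k * P.d)) P.eps⁻¹ U k Ω *ᵥ f) ⟨x₁, μ⟩)‖ ≤
          P.spacing k * (C * (1 + (P.L : ℝ) ^ k * ((R₀ - R₁)⁻¹ + (s : ℝ)⁻¹)) ^ 2 *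
            ((⌊(((P.L : ℝ) ^ k) - 1 + R₀) / s⌋₊ + 3) ^ (d + 1) * Real.exp (-(δ₀ * (((P.L : ℝ) ^ k)⁻¹ * (2 * R - 1)))) +
              Real.exp (-(δ₀ / 2 * (((P.L : ℝ) ^ k)⁻¹ * (R₁ - 1))))) *
            Real.exp (-(δ₀ / 2 * (((P.L : ℝ) ^ k)⁻¹ * D))) * F)  := by
  obtain ⟨δ₀, c₀, hδ₀, hc₀, HI⟩ := inputs6_smallPlaquette_region d ℓ hd1 hd3 hℓ hodd ha hθ0 hθ1
  obtain ⟨C, hC0, H⟩ := derivHolder231_region_of_inputs_of_smooth d hc₀.le hθ0 hθ1 hK₁ hK₂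
  refine ⟨δ₀, C * Real.exp (3 * δ₀), hδ₀, by positivity, ?_⟩
  intro P hPd hPL k hk1 hkK hbig U θp hθp0 hplaq hsm Ω hΩ c M0 hM0 hfit0 hN0 hsub0 s W hs R R₀ R₁ hR hR₁ hR10 hW hgap ζ hζabs hζ0 hζR₁
    hζ1 hζ2 x₁ x₂ μ hx₁ hdeep₁ hx₁e hdeep₁e hx₂ hdeep₂ hx₂e hdeep₂e f F D hF hD hsupp₁ hsupp₂
  obtain ⟨h1, h2, h3, h4, h5, h6⟩ := HI P hPd hPL k hk1 hkK hbig U θp hθp0 hplaq hsm Ω hΩ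
  have hρ0 : (0 : ℝ) ≤ 17 * (P.L : ℝ) ^ k := by positivity
  exact H P hPd a k hk1 hkK U Ω δ₀ (17 * (P.L : ℝ) ^ k) hδ₀ hρ0 h1 h2 h3 h4 h5 h6 c M0 hM0 hfit0 hN0 hsub0 s W hs R R₀ R₁
    (by linarith) hR₁ hR10 hW hgap ζ hζabs hζ0 hζR₁ hζ1 hζ2 x₁ x₂ μ hx₁ hdeep₁ hx₁e hdeep₁e hx₂ hdeep₂ hx₂e hdeep₂e f F D hF hD hsupp₁ hsupp₂

/-! ## §3 The member for the smooth product cut-off `ζ″ = ζ^Π(R₁, R₀)` of (2.29) -/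

section ZetaPiMember

open BIJ88LocDeriv230ZetaPiFlatTorus (zetaPi_zero_eq_zero_of_le zetaPi_zero_eq_one_of_le abs_zetaPi_zero_le_one abs_zetaPi_zero_shift_sub_le
  abs_zetaPi_zero_secondDiff_le)
open BIJ88HkLocHolderTorus (zetaPi secondDiffConst)
open Literature.Analysis.Calculus (exists_abs_deriv_and_deriv_deriv_smoothTransition_le)

set_option maxHeartbeats 800000 in
/-- **§2 AT r18's SMOOTH PRODUCT CUT-OFF `ζ″ = ζ^Π(R₁, R₀)` OF (2.29)** (print p. 263: *"ζ_k(x₁, x₂) is a smooth function of x₁ − x₂"*),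
hypothesis-free in the cut-off for `1 ≤ R₁ < R₀ ≤ (|T^{(0)}| − 3)/2` (`K₁ = C_σ`, `K₂ = C_σ² + C_σ` from the universal profile bound).
[cite: BalabanImbrieJaffe1988, (2.29), (2.31) p.263] [cite: BalabanImbrieJaffe1985, (7.3.1) p.326] [cite: Balaban1983RegularityDecay, Theorem p.573 (1.9), (1.11)–(1.12)] -/
theorem derivHolder231_smallPlaquette_region_zetaPi (d ℓ : ℕ) (hd1 : 1 ≤ d) (hd3 : d + 1 ≤ 3) (hℓ : 1 ≤ ℓ) (hodd : Odd (ℓ + 1))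
    {a : ℝ} (ha : 0 < a) {θ : ℝ} (hθ0 : 0 ≤ θ) (hθ1 : θ < 1) :
    ∃ δ₀ C : ℝ, 0 < δ₀ ∧ 0 < C ∧ ∀ (P : Params) (hPd : P.d = d + 1), P.L = ℓ + 1 →
      ∀ (k : ℕ), 1 ≤ k → k ≤ P.K → 2 * (P.L ^ k - 1) + 4 < P.sitesPerDir 0 →
      ∀ (U : GaugeField P 0 U1) (θp : ℝ), 0 ≤ θp → (∀ (y : Balaban1983to89.Site P 0) (μ ν : Fin P.d), ‖plaqC U y μ ν - 1‖ ≤ θp) →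
        (((P.L : ℝ) ^ k) ^ 2 * θp) ^ 2 ≤ 1 / 500 →
      ∀ (Ω : Finset (Balaban1983to89.Site P 0)), IsBlockUnion k Ω →
      ∀ (c M0 : Fin (d + 1) → ℕ), (∀ i, 1 ≤ M0 i) →
        (∀ i, c i * P.L ^ k + P.L ^ k * M0 i ≤ P.sitesPerDir 0) → (∀ i, P.L ^ k * M0 i < P.sitesPerDir 0) →
        (cubeT hPd (P.L ^ k) c fun i => P.L ^ k * M0 i) ⊆ Ω →
      ∀ (s W : ℕ), 1 ≤ s → ∀ (R R₀ R₁ : ℝ), 18 * (P.L : ℝ) ^ k + 3 ≤ R → 1 ≤ R₁ → R₁ < R₀ → R₀ ≤ ((P.sitesPerDir 0 : ℝ) - 3) / 2 →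
        2 * (s : ℝ) / 3 + R₀ / 2 + R ≤ W → (∀ i, ((P.L ^ k * M0 i : ℕ) : ℝ) + R ≤ P.sitesPerDir 0) →
      ∀ (x₁ x₂ : Balaban1983to89.Site P 0) (μ : Fin P.d),
        x₁ ∈ (cubeT hPd (P.L ^ k) c fun i => P.L ^ k * M0 i) →
        (∀ i, R₀ + R ≤ (boxCoord hPd (P.L ^ k) c x₁ i : ℝ) ∧ (boxCoord hPd (P.L ^ k) c x₁ i : ℝ) + (R₀ + R) ≤ (P.L ^ k * M0 i : ℕ) - 1) →
        x₁.shift μ ∈ (cubeT hPd (P.L ^ k) c fun i => P.L ^ k * M0 i) →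
        (∀ i, R₀ + R ≤ (boxCoord hPd (P.L ^ k) c (x₁.shift μ) i : ℝ) ∧
          (boxCoord hPd (P.L ^ k) c (x₁.shift μ) i : ℝ) + (R₀ + R) ≤ (P.L ^ k * M0 i : ℕ) - 1) →
        x₂ ∈ (cubeT hPd (P.L ^ k) c fun i => P.L ^ k * M0 i) →
        (∀ i, R₀ + R ≤ (boxCoord hPd (P.L ^ k) c x₂ i : ℝ) ∧ (boxCoord hPd (P.L ^ k) c x₂ i : ℝ) + (R₀ + R) ≤ (P.L ^ k * M0 i : ℕ) - 1) →
        x₂.shift μ ∈ (cubeT hPd (P.L ^ k) c fun i => P.L ^ k * M0 i) →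
        (∀ i, R₀ + R ≤ (boxCoord hPd (P.L ^ k) c (x₂.shift μ) i : ℝ) ∧
          (boxCoord hPd (P.L ^ k) c (x₂.shift μ) i : ℝ) + (R₀ + R) ≤ (P.L ^ k * M0 i : ℕ) - 1) →
      ∀ (f : Balaban1983to89.Site P 0 → ℂ) (F D : ℝ), (∀ y, ‖f y‖ ≤ F) → 0 ≤ D →
        (∀ y, f y ≠ 0 → D ≤ B5Ineq137Torus.T P 0 x₁ y) → (∀ y, f y ≠ 0 → D ≤ B5Ineq137Torus.T P 0 x₂ y) →
        ((P.L : ℝ) ^ k / B5Ineq137Torus.T P 0 x₁ x₂) ^ θ *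
          ‖stairHol U x₁ x₂ *
              (covD P.eps⁻¹ (cfg U)
                  (gLocT (B1RG242Torus.α P a k * (P.L : ℝ) ^ (k * P.d)) P.eps⁻¹ U k
                    (cubeFam hPd (P.L ^ k) c M0 s W) (lamFam hPd (P.L ^ k) c M0 s) (zetaPi R₁ R₀ 0) *ᵥ f) ⟨x₂, μ⟩ -
                covD P.eps⁻¹ (cfg U) (gBox (B1RG242Torus.α P a k * (P.L : ℝ) ^ (k * P.d)) P.eps⁻¹ U k Ω *ᵥ f) ⟨x₂, μ⟩) -
            (covD P.eps⁻¹ (cfg U)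
                (gLocT (B1RG242Torus.α P a k * (P.L : ℝ) ^ (k * P.d)) P.eps⁻¹ U k
                  (cubeFam hPd (P.L ^ k) c M0 s W) (lamFam hPd (P.L ^ k) c M0 s) (zetaPi R₁ R₀ 0) *ᵥ f) ⟨x₁, μ⟩ -
              covD P.eps⁻¹ (cfg U) (gBox (B1RG242Torus.α P a k * (P.L : ℝ) ^ (k * P.d)) P.eps⁻¹ U k Ω *ᵥ f) ⟨x₁, μ⟩)‖ ≤
          P.spacing k * (C * (1 + (P.L : ℝ) ^ k * ((R₀ - R₁)⁻¹ + (s : ℝ)⁻¹)) ^ 2 *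
            ((⌊(((P.L : ℝ) ^ k) - 1 + R₀) / s⌋₊ + 3) ^ (d + 1) * Real.exp (-(δ₀ * (((P.L : ℝ) ^ k)⁻¹ * (2 * R - 1)))) +
              Real.exp (-(δ₀ / 2 * (((P.L : ℝ) ^ k)⁻¹ * (R₁ - 1))))) *
            Real.exp (-(δ₀ / 2 * (((P.L : ℝ) ^ k)⁻¹ * D))) * F)  := by
  obtain ⟨Cσ, hCσ0, hCσ1, hCσ2⟩ := exists_abs_deriv_and_deriv_deriv_smoothTransition_le
  have hK₂ : 0 ≤ Cσ ^ 2 + Cσ := by positivity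
  obtain ⟨δ₀, C, hδ₀, hC0, H⟩ := derivHolder231_smallPlaquette_region_of_smooth d ℓ hd1 hd3 hℓ hodd ha hθ0 hθ1 hCσ0 hK₂
  refine ⟨δ₀, C, hδ₀, hC0, ?_⟩
  intro P hPd hPL k hk1 hkK hbig U θp hθp0 hplaq hsm Ω hΩ c M0 hM0 hfit0 hN0 hsub0 s W hs R R₀ R₁ hR hR₁ hR10 hR₀N hW hgap
    x₁ x₂ μ hx₁ hdeep₁ hx₁e hdeep₁e hx₂ hdeep₂ hx₂e hdeep₂e f F D hF hD hsupp₁ hsupp₂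
  have e : secondDiffConst Cσ R₁ R₀ = (Cσ ^ 2 + Cσ) / (R₀ - R₁) ^ 2 := by rw [secondDiffConst, div_pow, add_div]
  exact H P hPd hPL k hk1 hkK hbig U θp hθp0 hplaq hsm Ω hΩ c M0 hM0 hfit0 hN0 hsub0 s W hs R R₀ R₁ hR (zero_le_one.trans hR₁) hR10
    hW hgap
    (zetaPi R₁ R₀ 0) (abs_zetaPi_zero_le_one R₁ R₀) (zetaPi_zero_eq_zero_of_le hR10) (zetaPi_zero_eq_one_of_le hR10)
    (abs_zetaPi_zero_shift_sub_le hCσ1 hR10) (fun x y κ ν => (abs_zetaPi_zero_secondDiff_le hCσ1 hCσ2 hR10 hR₁ hR₀N x y κ ν).trans_eq e)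
    x₁ x₂ μ hx₁ hdeep₁ hx₁e hdeep₁e hx₂ hdeep₂ hx₂e hdeep₂e f F D hF hD hsupp₁ hsupp₂

end ZetaPiMember


/-! ## §4 The same at the ACTUAL BACKGROUND `u_k` of [I] (4.5.4) under the printed (7.3.1) — p34 gen 19's passage `smallPlaquette_actualBg` -/

section ActualBackground

open BIJ85Sect1Model (U1Field plaq)
open BIJ85Eq454PlaqResidual (actualBgU1)
open BIJ88NeumannPropagatorActualBackground (smallPlaquette_actualBg)
open BIJ88HkLocHolderTorus (zetaPi)

set_option maxHeartbeats 800000 in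
/-- **THE HÖLDER MEMBER OF ORDER `1 + θ` OF (2.31) FOR A `k`-BLOCK REGION `Ω ⊇ Ω₀` AT THE ACTUAL BACKGROUND `u_k` OF [I] (4.5.4) UNDER THE
PRINTED (7.3.1)** ([BalabanImbrieJaffe1985] p. 326: *"let us assume that for the unit lattice field v, |v(∂p) − 1| ≦ e_k𝓅(e_k), (7.3.1) … The
propagators arising from Δ_k(u_k), under the restriction (7.3.1) on the gauge field, also satisfy the regularity and decay estimates of [7]"*;
p. 263 (2.31) and *"Hölder derivatives of G_{k,loc}(u) of order less than two"*): §2 at `u = actualBgU1 hd2 k e v` — for an exponent `𝓅`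
there is `K ≥ 1` (p34 gen 19's threshold constant, from `(d, ℓ)`) and `δ₀, C > 0` such that for every coupling `0 < e ≤ 1` with
`e(1 + log e⁻¹)^𝓅 ≤ 1/(23(d+1)²K)` and every unit-lattice `U(1)` field `v` with `|v(∂q) − 1| ≤ e(1 + log e⁻¹)^𝓅` for all plaquettes `q`, the
conclusion of §2 holds for `u_k`, every `k`-block union `Ω ⊇ Ω₀` (in particular `Ω = T_η = univ`), every smooth cut-off.  p34's
`smallPlaquette_actualBg` (p359041) supplies `|u_k(∂p) − 1| ≤ θ_p`, `(L^{2k}θ_p)² ≤ 1/500` BY NAME; nothing about the passage is re-derived.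
[cite: BalabanImbrieJaffe1988, (2.31) p.263] [cite: BalabanImbrieJaffe1985, (7.3.1) p.326, (4.5.4) p.313] [cite: Balaban1983RegularityDecay, Theorem p.573 (1.9), (1.11)–(1.12)] -/
theorem derivHolder231_actualBg_region_of_smooth (d ℓ : ℕ) (hd1 : 1 ≤ d) (hd3 : d + 1 ≤ 3) (hℓ : 1 ≤ ℓ) (hodd : Odd (ℓ + 1))
    {a : ℝ} (ha : 0 < a) {θ : ℝ} (hθ0 : 0 ≤ θ) (hθ1 : θ < 1) {K₁ K₂ : ℝ} (hK₁ : 0 ≤ K₁) (hK₂ : 0 ≤ K₂) (pexp : ℝ) :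
    ∃ K δ₀ C : ℝ, 1 ≤ K ∧ 0 < δ₀ ∧ 0 < C ∧ ∀ (P : Params) (hPd : P.d = d + 1), P.L = ℓ + 1 →
      ∀ (hd2 : 2 ≤ P.d) (k : ℕ), 1 ≤ k → k ≤ P.K → 2 * (P.L ^ k - 1) + 4 < P.sitesPerDir 0 →
      ∀ (e : ℝ), 0 < e → e ≤ 1 → e * (1 + Real.log e⁻¹) ^ pexp ≤ 1 / (23 * (P.d : ℝ) ^ 2 * K) →
      ∀ (v : U1Field P k), (∀ q : Balaban1983to89.Plaq P k, ‖((plaq v q : Circle) : ℂ) - 1‖ ≤ e * (1 + Real.log e⁻¹) ^ pexp) →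
      ∀ (Ω : Finset (Balaban1983to89.Site P 0)), IsBlockUnion k Ω →
      ∀ (c M0 : Fin (d + 1) → ℕ), (∀ i, 1 ≤ M0 i) →
        (∀ i, c i * P.L ^ k + P.L ^ k * M0 i ≤ P.sitesPerDir 0) → (∀ i, P.L ^ k * M0 i < P.sitesPerDir 0) →
        (cubeT hPd (P.L ^ k) c fun i => P.L ^ k * M0 i) ⊆ Ω →
      ∀ (s W : ℕ), 1 ≤ s → ∀ (R R₀ R₁ : ℝ), 18 * (P.L : ℝ) ^ k + 3 ≤ R → 0 ≤ R₁ → R₁ < R₀ → 2 * (s : ℝ) / 3 + R₀ / 2 + R ≤ W →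
        (∀ i, ((P.L ^ k * M0 i : ℕ) : ℝ) + R ≤ P.sitesPerDir 0) →
      ∀ (ζ : Balaban1983to89.Site P 0 → Balaban1983to89.Site P 0 → ℝ), (∀ x y, |ζ x y| ≤ 1) →
        (∀ x y, R₀ ≤ B5Ineq137Torus.T P 0 x y → ζ x y = 0) → (∀ x y, B5Ineq137Torus.T P 0 x y ≤ R₁ → ζ x y = 1) →
        (∀ (x y : Balaban1983to89.Site P 0) (ν : Fin P.d), |ζ (x.shift ν) y - ζ x y| ≤ K₁ / (R₀ - R₁)) →
        (∀ (x y : Balaban1983to89.Site P 0) (κ ν : Fin P.d),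
          |ζ ((x.shift ν).shift κ) y - ζ (x.shift ν) y - ζ (x.shift κ) y + ζ x y| ≤ K₂ / (R₀ - R₁) ^ 2) →
      ∀ (x₁ x₂ : Balaban1983to89.Site P 0) (μ : Fin P.d),
        x₁ ∈ (cubeT hPd (P.L ^ k) c fun i => P.L ^ k * M0 i) →
        (∀ i, R₀ + R ≤ (boxCoord hPd (P.L ^ k) c x₁ i : ℝ) ∧ (boxCoord hPd (P.L ^ k) c x₁ i : ℝ) + (R₀ + R) ≤ (P.L ^ k * M0 i : ℕ) - 1) →
        x₁.shift μ ∈ (cubeT hPd (P.L ^ k) c fun i => P.L ^ k * M0 i) →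
        (∀ i, R₀ + R ≤ (boxCoord hPd (P.L ^ k) c (x₁.shift μ) i : ℝ) ∧
          (boxCoord hPd (P.L ^ k) c (x₁.shift μ) i : ℝ) + (R₀ + R) ≤ (P.L ^ k * M0 i : ℕ) - 1) →
        x₂ ∈ (cubeT hPd (P.L ^ k) c fun i => P.L ^ k * M0 i) →
        (∀ i, R₀ + R ≤ (boxCoord hPd (P.L ^ k) c x₂ i : ℝ) ∧ (boxCoord hPd (P.L ^ k) c x₂ i : ℝ) + (R₀ + R) ≤ (P.L ^ k * M0 i : ℕ) - 1) →
        x₂.shift μ ∈ (cubeT hPd (P.L ^ k) c fun i => P.L ^ k * M0 i) →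
        (∀ i, R₀ + R ≤ (boxCoord hPd (P.L ^ k) c (x₂.shift μ) i : ℝ) ∧
          (boxCoord hPd (P.L ^ k) c (x₂.shift μ) i : ℝ) + (R₀ + R) ≤ (P.L ^ k * M0 i : ℕ) - 1) →
      ∀ (f : Balaban1983to89.Site P 0 → ℂ) (F D : ℝ), (∀ y, ‖f y‖ ≤ F) → 0 ≤ D →
        (∀ y, f y ≠ 0 → D ≤ B5Ineq137Torus.T P 0 x₁ y) → (∀ y, f y ≠ 0 → D ≤ B5Ineq137Torus.T P 0 x₂ y) →
        ((P.L : ℝ) ^ k / B5Ineq137Torus.T P 0 x₁ x₂) ^ θ *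
          ‖stairHol (actualBgU1 hd2 k e v) x₁ x₂ *
              (covD P.eps⁻¹ (cfg (actualBgU1 hd2 k e v))
                  (gLocT (B1RG242Torus.α P a k * (P.L : ℝ) ^ (k * P.d)) P.eps⁻¹ (actualBgU1 hd2 k e v) k
                    (cubeFam hPd (P.L ^ k) c M0 s W) (lamFam hPd (P.L ^ k) c M0 s) ζ *ᵥ f) ⟨x₂, μ⟩ -
                covD P.eps⁻¹ (cfg (actualBgU1 hd2 k e v)) (gBox (B1RG242Torus.α P a k * (P.L : ℝ) ^ (k * P.d)) P.eps⁻¹ (actualBgU1 hd2 k e v) k Ω *ᵥ f) ⟨x₂, μ⟩) -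
            (covD P.eps⁻¹ (cfg (actualBgU1 hd2 k e v))
                (gLocT (B1RG242Torus.α P a k * (P.L : ℝ) ^ (k * P.d)) P.eps⁻¹ (actualBgU1 hd2 k e v) k
                  (cubeFam hPd (P.L ^ k) c M0 s W) (lamFam hPd (P.L ^ k) c M0 s) ζ *ᵥ f) ⟨x₁, μ⟩ -
              covD P.eps⁻¹ (cfg (actualBgU1 hd2 k e v)) (gBox (B1RG242Torus.α P a k * (P.L : ℝ) ^ (k * P.d)) P.eps⁻¹ (actualBgU1 hd2 k e v) k Ω *ᵥ f) ⟨x₁, μ⟩)‖ ≤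
          P.spacing k * (C * (1 + (P.L : ℝ) ^ k * ((R₀ - R₁)⁻¹ + (s : ℝ)⁻¹)) ^ 2 *
            ((⌊(((P.L : ℝ) ^ k) - 1 + R₀) / s⌋₊ + 3) ^ (d + 1) * Real.exp (-(δ₀ * (((P.L : ℝ) ^ k)⁻¹ * (2 * R - 1)))) +
              Real.exp (-(δ₀ / 2 * (((P.L : ℝ) ^ k)⁻¹ * (R₁ - 1))))) *
            Real.exp (-(δ₀ / 2 * (((P.L : ℝ) ^ k)⁻¹ * D))) * F)  := by
  obtain ⟨K, hK1, HK⟩ := smallPlaquette_actualBg (d := d + 1) (L := ℓ + 1) (by omega) pexp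
  obtain ⟨δ₀, C, hδ₀, hC, G⟩ := derivHolder231_smallPlaquette_region_of_smooth d ℓ hd1 hd3 hℓ hodd ha hθ0 hθ1 hK₁ hK₂
  refine ⟨K, δ₀, C, hK1, hδ₀, hC, ?_⟩
  intro P hPd hPL hd2 k hk1 hkK hbig e he he1 hsm v hv Ω hΩ c M0 hM0 hfit0 hN0 hsub0 s W hs R R₀ R₁ hR hR₁ hR10 hW hgap ζ hζabs hζ0 hζR₁
    hζ1 hζ2 x₁ x₂ μ hx₁ hdeep₁ hx₁e hdeep₁e hx₂ hdeep₂ hx₂e hdeep₂e f F D hF hD hsupp₁ hsupp₂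
  have hk : k ≤ P.m + P.K := hkK.trans (Nat.le_add_left _ _)
  obtain ⟨hθp0, hplaqC, -, -, -, -, hτ⟩ := HK P hPd hPL hd2 k hk1 hk e he he1 hsm v hv
  exact G P hPd hPL k hk1 hkK hbig (actualBgU1 hd2 k e v) _ hθp0 hplaqC hτ Ω hΩ c M0 hM0 hfit0 hN0 hsub0 s W hs R R₀ R₁ hR hR₁ hR10 hW hgap
    ζ hζabs hζ0 hζR₁ hζ1 hζ2 x₁ x₂ μ hx₁ hdeep₁ hx₁e hdeep₁e hx₂ hdeep₂ hx₂e hdeep₂e f F D hF hD hsupp₁ hsupp₂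

set_option maxHeartbeats 800000 in
/-- **§4 AT r18's SMOOTH PRODUCT CUT-OFF `ζ″ = ζ^Π(R₁, R₀)`, AT THE ACTUAL BACKGROUND `u_k` UNDER (7.3.1)** — §3 at `u = actualBgU1 hd2 k e v`,
hypothesis-free in the cut-off and in the field beyond the printed (7.3.1) with one threshold.
[cite: BalabanImbrieJaffe1988, (2.29), (2.31) p.263] [cite: BalabanImbrieJaffe1985, (7.3.1) p.326, (4.5.4) p.313] [cite: Balaban1983RegularityDecay, Theorem p.573 (1.9), (1.11)–(1.12)] -/
theorem derivHolder231_actualBg_region_zetaPi (d ℓ : ℕ) (hd1 : 1 ≤ d) (hd3 : d + 1 ≤ 3) (hℓ : 1 ≤ ℓ) (hodd : Odd (ℓ + 1))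
    {a : ℝ} (ha : 0 < a) {θ : ℝ} (hθ0 : 0 ≤ θ) (hθ1 : θ < 1) (pexp : ℝ) :
    ∃ K δ₀ C : ℝ, 1 ≤ K ∧ 0 < δ₀ ∧ 0 < C ∧ ∀ (P : Params) (hPd : P.d = d + 1), P.L = ℓ + 1 →
      ∀ (hd2 : 2 ≤ P.d) (k : ℕ), 1 ≤ k → k ≤ P.K → 2 * (P.L ^ k - 1) + 4 < P.sitesPerDir 0 →
      ∀ (e : ℝ), 0 < e → e ≤ 1 → e * (1 + Real.log e⁻¹) ^ pexp ≤ 1 / (23 * (P.d : ℝ) ^ 2 * K) →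
      ∀ (v : U1Field P k), (∀ q : Balaban1983to89.Plaq P k, ‖((plaq v q : Circle) : ℂ) - 1‖ ≤ e * (1 + Real.log e⁻¹) ^ pexp) →
      ∀ (Ω : Finset (Balaban1983to89.Site P 0)), IsBlockUnion k Ω →
      ∀ (c M0 : Fin (d + 1) → ℕ), (∀ i, 1 ≤ M0 i) →
        (∀ i, c i * P.L ^ k + P.L ^ k * M0 i ≤ P.sitesPerDir 0) → (∀ i, P.L ^ k * M0 i < P.sitesPerDir 0) →
        (cubeT hPd (P.L ^ k) c fun i => P.L ^ k * M0 i) ⊆ Ω →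
      ∀ (s W : ℕ), 1 ≤ s → ∀ (R R₀ R₁ : ℝ), 18 * (P.L : ℝ) ^ k + 3 ≤ R → 1 ≤ R₁ → R₁ < R₀ → R₀ ≤ ((P.sitesPerDir 0 : ℝ) - 3) / 2 →
        2 * (s : ℝ) / 3 + R₀ / 2 + R ≤ W → (∀ i, ((P.L ^ k * M0 i : ℕ) : ℝ) + R ≤ P.sitesPerDir 0) →
      ∀ (x₁ x₂ : Balaban1983to89.Site P 0) (μ : Fin P.d),
        x₁ ∈ (cubeT hPd (P.L ^ k) c fun i => P.L ^ k * M0 i) →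
        (∀ i, R₀ + R ≤ (boxCoord hPd (P.L ^ k) c x₁ i : ℝ) ∧ (boxCoord hPd (P.L ^ k) c x₁ i : ℝ) + (R₀ + R) ≤ (P.L ^ k * M0 i : ℕ) - 1) →
        x₁.shift μ ∈ (cubeT hPd (P.L ^ k) c fun i => P.L ^ k * M0 i) →
        (∀ i, R₀ + R ≤ (boxCoord hPd (P.L ^ k) c (x₁.shift μ) i : ℝ) ∧
          (boxCoord hPd (P.L ^ k) c (x₁.shift μ) i : ℝ) + (R₀ + R) ≤ (P.L ^ k * M0 i : ℕ) - 1) →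
        x₂ ∈ (cubeT hPd (P.L ^ k) c fun i => P.L ^ k * M0 i) →
        (∀ i, R₀ + R ≤ (boxCoord hPd (P.L ^ k) c x₂ i : ℝ) ∧ (boxCoord hPd (P.L ^ k) c x₂ i : ℝ) + (R₀ + R) ≤ (P.L ^ k * M0 i : ℕ) - 1) →
        x₂.shift μ ∈ (cubeT hPd (P.L ^ k) c fun i => P.L ^ k * M0 i) →
        (∀ i, R₀ + R ≤ (boxCoord hPd (P.L ^ k) c (x₂.shift μ) i : ℝ) ∧
          (boxCoord hPd (P.L ^ k) c (x₂.shift μ) i : ℝ) + (R₀ + R) ≤ (P.L ^ k * M0 i : ℕ) - 1) →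
      ∀ (f : Balaban1983to89.Site P 0 → ℂ) (F D : ℝ), (∀ y, ‖f y‖ ≤ F) → 0 ≤ D →
        (∀ y, f y ≠ 0 → D ≤ B5Ineq137Torus.T P 0 x₁ y) → (∀ y, f y ≠ 0 → D ≤ B5Ineq137Torus.T P 0 x₂ y) →
        ((P.L : ℝ) ^ k / B5Ineq137Torus.T P 0 x₁ x₂) ^ θ *
          ‖stairHol (actualBgU1 hd2 k e v) x₁ x₂ *
              (covD P.eps⁻¹ (cfg (actualBgU1 hd2 k e v))
                  (gLocT (B1RG242Torus.α P a k * (P.L : ℝ) ^ (k * P.d)) P.eps⁻¹ (actualBgU1 hd2 k e v) k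
                    (cubeFam hPd (P.L ^ k) c M0 s W) (lamFam hPd (P.L ^ k) c M0 s) (zetaPi R₁ R₀ 0) *ᵥ f) ⟨x₂, μ⟩ -
                covD P.eps⁻¹ (cfg (actualBgU1 hd2 k e v)) (gBox (B1RG242Torus.α P a k * (P.L : ℝ) ^ (k * P.d)) P.eps⁻¹ (actualBgU1 hd2 k e v) k Ω *ᵥ f) ⟨x₂, μ⟩) -
            (covD P.eps⁻¹ (cfg (actualBgU1 hd2 k e v))
                (gLocT (B1RG242Torus.α P a k * (P.L : ℝ) ^ (k * P.d)) P.eps⁻¹ (actualBgU1 hd2 k e v) k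
                  (cubeFam hPd (P.L ^ k) c M0 s W) (lamFam hPd (P.L ^ k) c M0 s) (zetaPi R₁ R₀ 0) *ᵥ f) ⟨x₁, μ⟩ -
              covD P.eps⁻¹ (cfg (actualBgU1 hd2 k e v)) (gBox (B1RG242Torus.α P a k * (P.L : ℝ) ^ (k * P.d)) P.eps⁻¹ (actualBgU1 hd2 k e v) k Ω *ᵥ f) ⟨x₁, μ⟩)‖ ≤
          P.spacing k * (C * (1 + (P.L : ℝ) ^ k * ((R₀ - R₁)⁻¹ + (s : ℝ)⁻¹)) ^ 2 *
            ((⌊(((P.L : ℝ) ^ k) - 1 + R₀) / s⌋₊ + 3) ^ (d + 1) * Real.exp (-(δ₀ * (((P.L : ℝ) ^ k)⁻¹ * (2 * R - 1)))) +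
              Real.exp (-(δ₀ / 2 * (((P.L : ℝ) ^ k)⁻¹ * (R₁ - 1))))) *
            Real.exp (-(δ₀ / 2 * (((P.L : ℝ) ^ k)⁻¹ * D))) * F)  := by
  obtain ⟨K, hK1, HK⟩ := smallPlaquette_actualBg (d := d + 1) (L := ℓ + 1) (by omega) pexp
  obtain ⟨δ₀, C, hδ₀, hC, G⟩ := derivHolder231_smallPlaquette_region_zetaPi d ℓ hd1 hd3 hℓ hodd ha hθ0 hθ1
  refine ⟨K, δ₀, C, hK1, hδ₀, hC, ?_⟩
  intro P hPd hPL hd2 k hk1 hkK hbig e he he1 hsm v hv Ω hΩ c M0 hM0 hfit0 hN0 hsub0 s W hs R R₀ R₁ hR hR₁ hR10 hR₀N hW hgap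
    x₁ x₂ μ hx₁ hdeep₁ hx₁e hdeep₁e hx₂ hdeep₂ hx₂e hdeep₂e f F D hF hD hsupp₁ hsupp₂
  have hk : k ≤ P.m + P.K := hkK.trans (Nat.le_add_left _ _)
  obtain ⟨hθp0, hplaqC, -, -, -, -, hτ⟩ := HK P hPd hPL hd2 k hk1 hk e he he1 hsm v hv
  exact G P hPd hPL k hk1 hkK hbig (actualBgU1 hd2 k e v) _ hθp0 hplaqC hτ Ω hΩ c M0 hM0 hfit0 hN0 hsub0 s W hs R R₀ R₁ hR hR₁ hR10 hR₀N
    hW hgap x₁ x₂ μ hx₁ hdeep₁ hx₁e hdeep₁e hx₂ hdeep₂ hx₂e hdeep₂e f F D hF hD hsupp₁ hsupp₂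

end ActualBackground

end

end Literature.MathematicalPhysics.QuantumFieldTheory.BalabanImbrieJaffe1984to88.BIJ88LocDerivHolder231SmallPlaquetteRegion
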